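import Mathlib.Analysis.InnerProductSpace.Calculus
import Mathlib.Analysis.SpecialFunctions.Complex.Arg
import Literature.Analysis.DeBrangesSpaces.Basic
import Literature.NumberTheory.LFunctions.WeilExplicit
import Literature.NumberTheory.LFunctions.WeilMellinBounds
import Literature.NumberTheory.LFunctions.WeilMellinInversion
import HarnessLib

/-!
# Causal crystallisation — auxiliary file 1: sign of the phase, the phase, decay lemmas

Helper file for the stub `stub_causalCrystallisation` of the line `causal-level-sets` for the
crux `WindowTraceArch` (stmt-RiemannHypothesis-11195; skeleton
`Summit.RiemannHypothesis.RiemannHypothesis.Cruxes.WindowTraceArch.CausalLevelSets`; the stub is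
proved in `Theorems/SpectralTraceWindowTraceArchStubCausalCrystallisation.lean`).

* `causalCLS_im_logDeriv_nonpos` : for a Hermite–Biehler function `E` and a real `t` with
  `E t ≠ 0`, `Im (E'(t)/E(t)) ≤ 0` (differentiate `y ↦ |E(t+iy)|² - |E(t-iy)|²`, which vanishes at
  `y = 0` and is positive for `y > 0`); so the de Branges phase `-arg E` increases along `ℝ`.
* `causalCLS_phase` : an entire `E` without real zeros has a differentiable phase `θ` on `ℝ`,
  `E(t) = |E(t)| e^{iθ(t)}`, `θ' = Im (E'/E)` (integrate the logarithmic derivative).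
* `causalCLS_weil_decay_pow`, `causalCLS_weil_decay_poly` : Schwartz decay of the transform
  `ĝ(1/2+it) = ∫ g(x) e^{itx} dx` of a Weil test on the critical line (iterate
  `weilMellin_deriv_deriv`).
* `causalCLS_weilMellin_offline` (registered sub-goal) : `‖ĝ(s)‖ ≤ e^{Ay} C_g/(1 + (Im s)²)` on the
  strip `|Re s - 1/2| ≤ y` when `supp g ⊆ [-A, A]` (Paley–Wiener growth of the transform of a
  function supported in `[-A, A]`, with the decay of two integrations by parts).

**Sources.** L. de Branges, *Hilbert Spaces of Entire Functions* (1968), §§19–22 (phase of a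
Hermite–Biehler function); standard Fourier analysis. All statements are folklore and proved here
from Mathlib and tree facts.
-/

set_option linter.dupNamespace false

noncomputable section

open Complex Set MeasureTheory Filter
open scoped Real Topology ComplexConjugate

namespace Summit.RiemannHypothesis.RiemannHypothesis.Theorems.SpectralTraceWindowTraceArch

open Literature.NumberTheory.LFunctions
open Literature.Analysis.DeBrangesSpaces (IsHermiteBiehler sharp)

/-! ### The sign of `Im (E'/E)` on the real axis -/

/-- For a Hermite–Biehler function `E` and a real point `t` with `E t ≠ 0`:
`Im (conj (E t) · E'(t)) ≤ 0`. The function `g(y) = |E(t+iy)|² - |E(t-iy)|²` vanishes at `0`, is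
positive for `y > 0`, and `g'(0) = -4 Im (conj (E t) E'(t))`. -/
theorem causalCLS_im_conj_mul_deriv_nonpos {E : ℂ → ℂ} (hE : IsHermiteBiehler E) (t : ℝ) :
    (conj (E t) * deriv E t).im ≤ 0 := by
  -- the two slices
  set u : ℝ → ℂ := fun y => E ((t : ℂ) + (y : ℂ) * I) with hu
  set w : ℝ → ℂ := fun y => E ((t : ℂ) - (y : ℂ) * I) with hw
  have hline : ∀ c : ℂ, HasDerivAt (fun y : ℝ => (t : ℂ) + (y : ℂ) * c) c 0 := by
    intro c
    have h := ((hasDerivAt_id (0 : ℝ)).ofReal_comp.mul_const c).const_add (t : ℂ)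
    simpa using h
  have hE0 : HasDerivAt E (deriv E t) ((t : ℂ) + ((0 : ℝ) : ℂ) * I) := by
    have : ((t : ℂ) + ((0 : ℝ) : ℂ) * I) = t := by simp
    rw [this]
    exact (hE.differentiable t).hasDerivAt
  have hE0' : HasDerivAt E (deriv E t) ((t : ℂ) + ((0 : ℝ) : ℂ) * (-I)) := by
    have : ((t : ℂ) + ((0 : ℝ) : ℂ) * (-I)) = t := by simp
    rw [this]
    exact (hE.differentiable t).hasDerivAt
  have hud : HasDerivAt u (deriv E t * I) 0 := by
    have h := hE0.comp (0 : ℝ) (hline I)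
    exact h
  have hwd : HasDerivAt w (deriv E t * (-I)) 0 := by
    have h := hE0'.comp (0 : ℝ) (hline (-I))
    refine (h.congr_of_eventuallyEq ?_)
    exact Eventually.of_forall fun y => by simp [hw, sub_eq_add_neg]
  -- the difference of squared norms
  have hg : HasDerivAt (fun y => ‖u y‖ ^ 2 - ‖w y‖ ^ 2)
      (2 * inner ℝ (u 0) (deriv E t * I) - 2 * inner ℝ (w 0) (deriv E t * (-I))) 0 :=
    hud.norm_sq.sub hwd.norm_sq
  have hu0 : u 0 = E t := by simp [hu]
  have hw0 : w 0 = E t := by simp [hw]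
  rw [hu0, hw0, Complex.inner, Complex.inner] at hg
  have hval : 2 * (deriv E t * I * conj (E t)).re - 2 * (deriv E t * -I * conj (E t)).re =
      -4 * (conj (E t) * deriv E t).im := by
    have e1 : deriv E t * I * conj (E t) = I * (conj (E t) * deriv E t) := by ring
    have e2 : deriv E t * -I * conj (E t) = -(I * (conj (E t) * deriv E t)) := by ring
    rw [e1, e2, Complex.neg_re, Complex.I_mul_re]
    ring
  rw [hval] at hg
  -- the slope from the right is positive
  have hslope : Tendsto (slope (fun y => ‖u y‖ ^ 2 - ‖w y‖ ^ 2) 0) (𝓝[>] (0 : ℝ))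
      (𝓝 (-4 * (conj (E t) * deriv E t).im)) := by
    have h := hg.hasDerivWithinAt (s := Ioi (0 : ℝ))
    rwa [hasDerivWithinAt_iff_tendsto_slope' (by simp)] at h
  have hpos : ∀ᶠ y in 𝓝[>] (0 : ℝ), 0 ≤ slope (fun y => ‖u y‖ ^ 2 - ‖w y‖ ^ 2) 0 y := by
    filter_upwards [self_mem_nhdsWithin] with y hy
    rw [slope_def_field, hu0, hw0, sub_self, sub_zero, sub_zero]
    refine div_nonneg ?_ (le_of_lt hy)
    have hz : 0 < (((t : ℂ) + (y : ℂ) * I)).im := by simpa using hy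
    have hlt := hE.norm_conj_lt _ hz
    have hc : conj ((t : ℂ) + (y : ℂ) * I) = (t : ℂ) - (y : ℂ) * I := by
      apply Complex.ext <;> simp
    rw [hc] at hlt
    have h0 : 0 ≤ ‖E ((t : ℂ) - (y : ℂ) * I)‖ := norm_nonneg _
    simp only [hu, hw]
    nlinarith
  have hge : 0 ≤ -4 * (conj (E t) * deriv E t).im := ge_of_tendsto hslope hpos
  linarith

/-- For a Hermite–Biehler function `E` and a real `t` with `E t ≠ 0`: `Im (E'(t)/E(t)) ≤ 0`, i.e.
the phase of `E` decreases along the real axis (de Branges' phase function is increasing). -/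
theorem causalCLS_im_logDeriv_nonpos {E : ℂ → ℂ} (hE : IsHermiteBiehler E) (t : ℝ)
    (hEt : E t ≠ 0) : (deriv E t / E t).im ≤ 0 := by
  have h := causalCLS_im_conj_mul_deriv_nonpos hE t
  have hn : 0 < Complex.normSq (E t) := Complex.normSq_pos.2 hEt
  have e : conj (E t) * deriv E t = (deriv E t / E t) * (Complex.normSq (E t) : ℂ) := by
    rw [← Complex.mul_conj]
    field_simp
  rw [e, Complex.im_mul_ofReal, ← zero_mul (Complex.normSq (E t))] at h
  exact le_of_mul_le_mul_right h hn

/-! ### A continuous phase for an entire function without real zeros -/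

/-- An entire function `E` without real zeros has a differentiable phase on the real axis:
there is `θ : ℝ → ℝ` with `E(t) = |E(t)| e^{iθ(t)}` and `θ'(t) = Im (E'(t)/E(t))` (integrate the
logarithmic derivative: `E(t) = E(0) exp (∫₀ᵗ E'/E)`). -/
theorem causalCLS_phase {E : ℂ → ℂ} (hd : Differentiable ℂ E) (h0 : ∀ t : ℝ, E t ≠ 0) :
    ∃ θ : ℝ → ℝ, (∀ t : ℝ, HasDerivAt θ (deriv E t / E t).im t) ∧
      ∀ t : ℝ, E t = ((‖E t‖ : ℝ) : ℂ) * cexp (((θ t : ℝ) : ℂ) * I) := by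
  -- the logarithmic derivative along the real axis
  set ℓ : ℝ → ℂ := fun t => deriv E t / E t with hℓ
  have hℓc : Continuous ℓ := by
    have h1 : Continuous (deriv E) := (hd.contDiff (n := 1)).continuous_deriv le_rfl
    exact (h1.comp continuous_ofReal).div (hd.continuous.comp continuous_ofReal) h0
  set Φ : ℝ → ℂ := fun t => ∫ s in (0 : ℝ)..t, ℓ s with hΦ
  have hΦd : ∀ t, HasDerivAt Φ (ℓ t) t := fun t =>
    (hℓc.integral_hasStrictDerivAt 0 t).hasDerivAt
  have hΦ0 : Φ 0 = 0 := by simp [hΦ]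
  -- `E(t) e^{-Φ(t)}` is constant
  have hEd : ∀ t : ℝ, HasDerivAt (fun s : ℝ => E s) (deriv E t) t := fun t =>
    (hd t).hasDerivAt.comp_ofReal
  have hconst : ∀ t : ℝ, E t * cexp (-Φ t) = E 0 := by
    have hF : ∀ t, HasDerivAt (fun s : ℝ => E s * cexp (-Φ s)) 0 t := by
      intro t
      have h : HasDerivAt (fun s : ℝ => E s * cexp (-Φ s))
          (deriv E t * cexp (-Φ t) + E t * (cexp (-Φ t) * -ℓ t)) t :=
        (hEd t).mul ((hΦd t).neg.cexp)
      have e : deriv E t * cexp (-Φ t) + E t * (cexp (-Φ t) * -ℓ t) = 0 := by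
        simp only [hℓ]
        field_simp [h0 t]
        ring
      exact h.congr_deriv e
    have hdiff : Differentiable ℝ (fun s : ℝ => E s * cexp (-Φ s)) := fun t =>
      (hF t).differentiableAt
    have hc := is_const_of_deriv_eq_zero hdiff (fun t => (hF t).deriv)
    intro t
    rw [hc t 0, hΦ0, neg_zero, Complex.exp_zero, mul_one, Complex.ofReal_zero]
  have hEexp : ∀ t : ℝ, E t = E 0 * cexp (Φ t) := by
    intro t
    calc E t = E t * cexp (-Φ t) * cexp (Φ t) := by
          rw [mul_assoc, ← Complex.exp_add, neg_add_cancel, Complex.exp_zero, mul_one]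
      _ = E 0 * cexp (Φ t) := by rw [hconst t]
  refine ⟨fun t => Complex.arg (E 0) + (Φ t).im, fun t => ?_, fun t => ?_⟩
  · -- derivative of the phase
    have h := (Complex.imCLM.hasFDerivAt.comp_hasDerivAt t (hΦd t)).const_add (Complex.arg (E 0))
    simpa using h
  · have h3 : cexp (Φ t) = ((Real.exp (Φ t).re : ℝ) : ℂ) * cexp ((((Φ t).im : ℝ) : ℂ) * I) := by
      rw [Complex.ofReal_exp, ← Complex.exp_add, Complex.re_add_im]
    have h4 : ‖E t‖ = ‖E 0‖ * Real.exp (Φ t).re := by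
      rw [hEexp t, norm_mul, Complex.norm_exp]
    symm
    calc ((‖E t‖ : ℝ) : ℂ) * cexp (((Complex.arg (E 0) + (Φ t).im : ℝ) : ℂ) * I)
        = (((‖E 0‖ : ℝ) : ℂ) * cexp (((Complex.arg (E 0) : ℝ) : ℂ) * I)) *
            (((Real.exp (Φ t).re : ℝ) : ℂ) * cexp ((((Φ t).im : ℝ) : ℂ) * I)) := by
          rw [h4]; push_cast; rw [add_mul, Complex.exp_add]; ring
      _ = E 0 * cexp (Φ t) := by rw [Complex.norm_mul_exp_arg_mul_I, ← h3]
      _ = E t := (hEexp t).symm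

/-! ### Schwartz decay of the transform of a Weil test on the critical line -/

/-- Iterated decay: for a Weil test `g` and `k : ℕ`, `(1+t²)^k ‖ĝ(1/2+it)‖` is bounded
(`2k` integrations by parts, `weilMellin_deriv_deriv`). -/
theorem causalCLS_weil_decay_pow (k : ℕ) :
    ∀ {g : ℝ → ℂ}, IsWeilTest g →
      ∃ D : ℝ, ∀ t : ℝ, (1 + t ^ 2) ^ k * ‖weilMellin g (1 / 2 + (t : ℂ) * I)‖ ≤ D := by
  induction k with
  | zero =>
    intro g hg
    refine ⟨weilL1 g, fun t => ?_⟩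
    rw [pow_zero, one_mul]
    exact norm_weilMellin_le_weilL1 hg.1.continuous hg.2 (by simp) (by simp; norm_num)
  | succ k ih =>
    intro g hg
    obtain ⟨D₁, hD₁⟩ := ih hg
    obtain ⟨D₂, hD₂⟩ := ih hg.deriv.deriv
    refine ⟨D₁ + D₂, fun t => ?_⟩
    have h2 := hD₂ t
    rw [weilMellin_deriv_deriv hg, norm_mul] at h2
    have h3 : ‖((1 : ℂ) / 2 + (t : ℂ) * I - 1 / 2) ^ 2‖ = t ^ 2 := by
      rw [add_sub_cancel_left, norm_pow, norm_mul, Complex.norm_real, Complex.norm_I, mul_one,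
        Real.norm_eq_abs, sq_abs]
    rw [h3] at h2
    have h1 := hD₁ t
    have e : (1 + t ^ 2) ^ (k + 1) * ‖weilMellin g (1 / 2 + (t : ℂ) * I)‖ =
        (1 + t ^ 2) ^ k * ‖weilMellin g (1 / 2 + (t : ℂ) * I)‖ +
          (1 + t ^ 2) ^ k * (t ^ 2 * ‖weilMellin g (1 / 2 + (t : ℂ) * I)‖) := by ring
    rw [e]
    exact add_le_add h1 h2

/-- Polynomially weighted decay: for a Weil test `g` and `N : ℕ` there is `C ≥ 0` with
`(1+|t|)^N ‖ĝ(1/2+it)‖ ≤ C/(1+t²)` for all real `t`. -/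
theorem causalCLS_weil_decay_poly (N : ℕ) {g : ℝ → ℂ} (hg : IsWeilTest g) :
    ∃ C : ℝ, 0 ≤ C ∧ ∀ t : ℝ,
      (1 + |t|) ^ N * ‖weilMellin g (1 / 2 + (t : ℂ) * I)‖ ≤ C / (1 + t ^ 2) := by
  obtain ⟨D, hD⟩ := causalCLS_weil_decay_pow (N + 1) hg
  have hD0 : 0 ≤ D := by
    have h := hD 0
    have : 0 ≤ (1 + (0 : ℝ) ^ 2) ^ (N + 1) * ‖weilMellin g (1 / 2 + ((0 : ℝ) : ℂ) * I)‖ := by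
      positivity
    linarith
  refine ⟨2 ^ N * D, by positivity, fun t => ?_⟩
  have hpos : 0 < 1 + t ^ 2 := by positivity
  rw [le_div_iff₀ hpos]
  have h1 : (1 + |t|) ^ N ≤ (2 * (1 + t ^ 2)) ^ N := by
    refine pow_le_pow_left₀ (by positivity) ?_ N
    nlinarith [abs_nonneg t, sq_abs t, sq_nonneg (|t| - 1)]
  have h2 := hD t
  calc (1 + |t|) ^ N * ‖weilMellin g (1 / 2 + (t : ℂ) * I)‖ * (1 + t ^ 2)
      ≤ (2 * (1 + t ^ 2)) ^ N * ‖weilMellin g (1 / 2 + (t : ℂ) * I)‖ * (1 + t ^ 2) := by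
        gcongr
    _ = 2 ^ N * ((1 + t ^ 2) ^ (N + 1) * ‖weilMellin g (1 / 2 + (t : ℂ) * I)‖) := by
        rw [mul_pow]; ring
    _ ≤ 2 ^ N * D := by gcongr

/-! ### Growth of the transform off the critical line -/

/-- The weighted `L¹` norm of a function supported in `[-A, A]`: for `y ≥ 0`,
`∫ ‖g‖ e^{y|t|} ≤ e^{Ay} ∫ ‖g‖`. -/
theorem causalCLS_weilL1W_le {g : ℝ → ℂ} (hg : Continuous g) (hg' : HasCompactSupport g) {A : ℝ}
    (hgA : tsupport g ⊆ Icc (-A) A) {y : ℝ} (hy : 0 ≤ y) :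
    weilL1W y g ≤ Real.exp (A * y) * weilL1W 0 g := by
  unfold weilL1W
  rw [← integral_const_mul]
  refine integral_mono_of_nonneg (Eventually.of_forall fun t => by positivity) ?_
    (Eventually.of_forall fun t => ?_)
  · exact ((hg.norm.mul (by fun_prop)).integrable_of_hasCompactSupport
      hg'.norm.mul_right).const_mul _
  · simp only [zero_mul, Real.exp_zero, mul_one]
    by_cases ht : g t = 0
    · simp [ht]
    · have hts : t ∈ tsupport g := subset_tsupport _ (Function.mem_support.2 ht)
      have htA := hgA hts
      have habs : |t| ≤ A := abs_le.2 ⟨by linarith [htA.1], htA.2⟩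
      rw [mul_comm (Real.exp (A * y))]
      refine mul_le_mul_of_nonneg_left (Real.exp_le_exp.2 ?_) (norm_nonneg _)
      nlinarith

/-- **Growth of `ĝ` off the critical line.** For a Weil test `g` supported in `[-A, A]`, `y ≥ 0`
and `|Re s - 1/2| ≤ y`: `‖ĝ(s)‖ ≤ e^{Ay} C_g/(1 + (Im s)²)` with `C_g = weilDecayW 0 g`
(Paley–Wiener growth `e^{A|Im z|}` of the Fourier transform of a function supported in `[-A,A]`,
with the decay of two integrations by parts). -/
theorem causalCLS_weilMellin_offline :
    ∀ (g : ℝ → ℂ) (A y : ℝ) (s : ℂ), IsWeilTest g → tsupport g ⊆ Icc (-A) A → 0 ≤ y →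
      |s.re - 1 / 2| ≤ y →
      ‖weilMellin g s‖ ≤ Real.exp (A * y) * weilDecayW 0 g / (1 + s.im ^ 2) := by
  intro g A y s hg hgA hy hs
  have h1 := norm_weilMellin_le_of_abs_re_le hg hs
  refine h1.trans (div_le_div_of_nonneg_right ?_ (by positivity))
  unfold weilDecayW
  have hdd : IsWeilTest (deriv (deriv g)) := hg.deriv.deriv
  have hA1 := causalCLS_weilL1W_le hg.1.continuous hg.2 hgA hy
  have hA2 := causalCLS_weilL1W_le hdd.1.continuous hdd.2
    ((tsupport_deriv_subset.trans tsupport_deriv_subset).trans hgA) hy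
  rw [mul_add]
  exact add_le_add hA1 hA2

end Summit.RiemannHypothesis.RiemannHypothesis.Theorems.SpectralTraceWindowTraceArch

end
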